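import Summits.AtomisticToContinuum.FouriersLaw.Theorems.PhononMeanFreePathIncoherentChannelTwoHorizonsMean
import Summits.AtomisticToContinuum.FouriersLaw.Theorems.PhononMeanFreePathHarmonicCoherentPersistence

/-!
# The forecast-loss envelope is FALSE at the harmonic corner (calibration of `stub_forecastLoss`)

Line `two-horizons-forecast-loss` of crux `PhononMeanFreePath.IncoherentChannel`
(stmt-AtomisticToContinuum-11811). The lead's open stub `stub_forecastLoss` asserts, for the
ANHARMONIC pinned chain (`lam, β > 0`), the `N`-uniform forecast-loss envelope
`S_N(t) = fnorm … N t = ‖K_t p_N‖²_{L²(μ_T)} ≤ C (1+t)^{-α}` with `α > 2`; the landed composition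
`coherentDephasing_of_forecastLoss` shows that this envelope ALONE implies the route's crux
`CoherentDephasing`. This file is the CALIBRATION: the same envelope is FALSE at the harmonic
corner `lam = β = 0`, where `CoherentDephasing` fails (`harmonicCoherentPersistence_proof`). So the
hypothesis of the line carries genuine anharmonic content (rigorous version of the MD "harmonic
plateau" `S_N ≈ 0.15·T` up to `t ≈ N/v`).

Assembly of landed pieces only:

* `lightConeH_of_nonneg` — the causality window `|P_N(t)| + r_N(t)² ≤ ε_N` on `t ≤ N^η`,
  `N^{1+η} ε_N → 0`, at every coupling `lam, β, γ ≥ 0` (verbatim the proof of `stub_lightCone`,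
  whose inputs `lightCone_reduction` / `lightCone_propagation_mean` are corner-capable);
* `forecastLossH_commonPastBound_of_nonneg` — the fixed-`N` dictionary at `lam, β, γ ≥ 0`;
* `twoHorizonsAt_pairCorr_channel` — at ONE parameter point with `lam, β, γ ≥ 0`, the pointwise
  envelope `S_N(t) ≤ C(1+t)^{-α}` (`α > 2`) forces `N·∫₀^∞ r_N² → 0` (the `r²` half of
  `twoHorizons_meanChannels`: window `N^θ`, majorant `T·C·(1+t)^{-α}`, tail `≲ N^{1+θ(1-α)} → 0`);
* `forecastLossEnvelope_false_harmonic` — at `lam = β = 0` this contradicts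
  `HarmonicCoherentPersistence` (`N·∫₀^∞ r_N² ↛ 0`, Rieder–Lebowitz–Lieb ballistic conductance).
-/

noncomputable section

namespace Summit.AtomisticToContinuum.FouriersLaw.Theorems.PhononMeanFreePath

open MeasureTheory Set Filter Topology
open scoped NNReal
open Literature.MathematicalPhysics.KineticTheory.HeatConduction

/-! ### The causality window at every coupling `lam, β, γ ≥ 0` -/

/-- **Light cone at every coupling (including the harmonic corner).** For the pinned chain
`pinnedChain ω₂ lam β γ` with `ω₂ > 0`, `lam, β, γ ≥ 0`, both baths at `T > 0`, and every fixed
`0 < η < 1`, there is `ε_N` with `N^{1+η} ε_N → 0` and `|P_N(t)| + r_N(t)² ≤ ε_N` for all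
`0 ≤ t ≤ N^η` — the proof of `stub_lightCone` verbatim (`lightCone_reduction`,
`lightCone_propagation_mean` with `Λ = (N+1)/8`, `2^k ≥ 5/(1-η)`). [folklore] -/
theorem lightConeH_of_nonneg : ∀ ω₂ lam β γ : ℝ, 0 < ω₂ → 0 ≤ lam → 0 ≤ β → 0 ≤ γ → ∀ T : ℝ, 0 < T →
    ∀ η : ℝ, 0 < η → η < 1 → ∃ ε : ℕ → ℝ, Tendsto (fun N : ℕ => (N : ℝ) ^ (1 + η) * ε N) atTop (𝓝 0) ∧
      ∀ (N : ℕ) (t : ℝ), 0 ≤ t → t ≤ (N : ℝ) ^ η →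
        |commonPast ω₂ lam β γ T N t| + (pairCorr ω₂ lam β γ T N t) ^ 2 ≤ ε N := by
  intro ω₂ lam β γ hω hl hβ hγ T hT η hη hη1
  obtain ⟨K, hK0, hK⟩ := lightCone_reduction ω₂ lam β γ hω hl hβ hγ T hT
  -- the power `M = 2^k ≥ 5/(1-η)`
  obtain ⟨k, hk⟩ : ∃ k : ℕ, 5 / (1 - η) ≤ (2 : ℝ) ^ k := by
    obtain ⟨n, hn⟩ := exists_nat_ge (5 / (1 - η))
    refine ⟨n, hn.trans ?_⟩
    exact_mod_cast (Nat.lt_two_pow_self).le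
  obtain ⟨C, hC0, hC⟩ := lightCone_propagation_mean ω₂ lam β γ hω hl hβ hγ T hT k
  set M : ℕ := 2 ^ k with hMdef
  have hMη : 5 ≤ (M : ℝ) * (1 - η) := by
    have h1η : 0 < 1 - η := by linarith
    have : (5 : ℝ) / (1 - η) * (1 - η) = 5 := by field_simp
    have hM : ((M : ℕ) : ℝ) = (2 : ℝ) ^ k := by rw [hMdef]; push_cast; ring
    rw [hM]
    nlinarith
  -- the bound sequence
  set ρ : ℝ := Real.exp (9 / 8) / 8 with hρ
  have hρ0 : 0 ≤ ρ := by positivity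
  have hρ1 : ρ < 1 := by rw [hρ, div_lt_one (by norm_num)]; exact lightCone_exp_nine_eighths_lt
  set s : ℝ := (M : ℝ) * (1 - η) - 1 / 2 with hs
  have hs_exp : η * M + 1 / 2 - M = -s := by rw [hs]; ring
  set B : ℕ → ℝ := fun N => 32 * T * ρ ^ (N + 1) + C * 8 ^ M * ((N : ℝ) + 1) ^ (-s) with hB
  have hB0 : ∀ N, 0 ≤ B N := fun N => by positivity
  -- `D_N(t) ≤ B_N` inside the window
  have hDB : ∀ (N : ℕ) (t : ℝ), 0 ≤ t → t ≤ (N : ℝ) ^ η →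
      ∫ x : PhaseSpace (N + 1) × ℝ, (fcast ω₂ lam β γ T N t x.1 -
          fcast ω₂ lam β γ T N t ((x.1.1, Function.update x.1.2 0 x.2) : PhaseSpace (N + 1))) ^ 2
          ∂(((pinnedChain ω₂ lam β γ).gibbsMeasure (N + 1) T).prod (ProbabilityTheory.gaussianReal 0 T.toNNReal)) ≤ B N := by
    intro N t ht htN
    have hΛ : (0 : ℝ) < ((N : ℝ) + 1) / 8 := by positivity
    refine (hC N t ht _ hΛ).trans ?_
    have h1 : 4 * T * (Real.exp (((N : ℝ) + 1) / 8) * (((N : ℝ) + 1) / 8) ^ N / N.factorial) ≤ 32 * T * ρ ^ (N + 1) := by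
      have := mul_le_mul_of_nonneg_left (lightCone_inCone_le N) (by positivity : (0 : ℝ) ≤ 4 * T)
      rw [hρ]; linarith
    have h2 := lightCone_outCone_le hC0 hη.le N M ht htN
    rw [hs_exp] at h2
    exact add_le_add h1 h2
  -- `ε`
  refine ⟨fun N => K * Real.sqrt (B N) + T * B N, ?_, fun N t ht htN => ?_⟩
  · -- `N^{1+η} ε_N → 0`
    have hBt : ∀ e : ℝ, 0 ≤ e → e ≤ 4 → e < s → Tendsto (fun N : ℕ => (N : ℝ) ^ e * B N) atTop (𝓝 0) := by
      intro e he0 he4 hes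
      have hA := (lightCone_tendsto_rpow_mul_geom he0 he4 hρ0 hρ1).const_mul (32 * T)
      have hB' := (lightCone_tendsto_rpow_mul_rpow_neg he0 hes).const_mul (C * 8 ^ M)
      have := hA.add hB'
      simp only [mul_zero, add_zero] at this
      refine this.congr fun N => ?_
      simp only [hB]; ring
    have hs4 : 4 < s := by rw [hs]; linarith
    have e1 : ∀ N : ℕ, (N : ℝ) ^ (1 + η) * Real.sqrt (B N) = Real.sqrt ((N : ℝ) ^ (2 + 2 * η) * B N) := by
      intro N
      have hN0 : (0 : ℝ) ≤ N := Nat.cast_nonneg N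
      have hsq : Real.sqrt ((N : ℝ) ^ (2 + 2 * η)) = (N : ℝ) ^ (1 + η) := by
        rw [Real.sqrt_eq_rpow, ← Real.rpow_mul hN0]
        congr 1; ring
      rw [Real.sqrt_mul (Real.rpow_nonneg hN0 _), hsq]
    have hT1 : Tendsto (fun N : ℕ => Real.sqrt ((N : ℝ) ^ (2 + 2 * η) * B N)) atTop (𝓝 0) := by
      have := (hBt (2 + 2 * η) (by linarith) (by linarith) (by linarith)).sqrt
      rwa [Real.sqrt_zero] at this
    have hT2 := hBt (1 + η) (by linarith) (by linarith) (by linarith)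
    have := (hT1.const_mul K).add (hT2.const_mul T)
    simp only [mul_zero, add_zero] at this
    refine this.congr fun N => ?_
    rw [← e1]; ring
  · -- the bound
    obtain ⟨hr, hP⟩ := hK N t
    set D := ∫ x : PhaseSpace (N + 1) × ℝ, (fcast ω₂ lam β γ T N t x.1 -
        fcast ω₂ lam β γ T N t ((x.1.1, Function.update x.1.2 0 x.2) : PhaseSpace (N + 1))) ^ 2
        ∂(((pinnedChain ω₂ lam β γ).gibbsMeasure (N + 1) T).prod (ProbabilityTheory.gaussianReal 0 T.toNNReal)) with hD
    have hDB' : D ≤ B N := hDB N t ht htN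
    have h1 : K * Real.sqrt D ≤ K * Real.sqrt (B N) := mul_le_mul_of_nonneg_left (Real.sqrt_le_sqrt hDB') hK0
    have h2 : T * D ≤ T * B N := mul_le_mul_of_nonneg_left hDB' hT.le
    linarith

/-! ### The fixed-`N` dictionary at every coupling `lam, β, γ ≥ 0` -/

/-- **Fixed-`N` dictionary at every coupling (including the harmonic corner)**: measurability of
`t ↦ P_N(t)`, `t ↦ r_N(t)`; `r_N(t)² ≤ T·S_N(t)`; and `|P_N(t)| ≤ K(θ,T)·S_N(t)^θ` for every
`θ ∈ (0,1)` — the conjuncts of `stub_commonPastBound`, from the corner-capable lemmas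
`commonPastBound_measurable_*`, `commonPastBound_pairCorr_sq_le`, `commonPastBound_exists_const`.
[folklore] -/
theorem forecastLossH_commonPastBound_of_nonneg {ω₂ lam β γ T : ℝ} (hω : 0 < ω₂) (hl : 0 ≤ lam)
    (hβ : 0 ≤ β) (hγ : 0 ≤ γ) (hT : 0 < T) :
    (∀ N : ℕ, Measurable (commonPast ω₂ lam β γ T N) ∧ Measurable (pairCorr ω₂ lam β γ T N)) ∧
    (∀ (N : ℕ) (t : ℝ), (pairCorr ω₂ lam β γ T N t) ^ 2 ≤ T * fnorm ω₂ lam β γ T N t) ∧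
    ∀ θ : ℝ, 0 < θ → θ < 1 → ∃ K : ℝ, ∀ (N : ℕ) (t : ℝ),
      |commonPast ω₂ lam β γ T N t| ≤ K * (fnorm ω₂ lam β γ T N t) ^ θ :=
  ⟨fun N => ⟨commonPastBound_measurable_commonPast hω hl hβ hγ hT N,
      commonPastBound_measurable_pairCorr hω hl hβ hγ hT N⟩,
    fun N t => commonPastBound_pairCorr_sq_le hω hl hβ hγ hT N t,
    fun _ hθ0 hθ1 => commonPastBound_exists_const hω hl hβ hγ hT hθ0 hθ1⟩

/-! ### The coherent mean channel at one parameter point, from the pointwise envelope -/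

/-- **The `r²` horizon argument at ONE parameter point** (`ω₂ > 0`, `lam, β, γ ≥ 0`, `T > 0`): if
`S_N(t) ≤ C (1+t)^{-α}` for all `N`, `t ≥ 0` with `α > 2`, then `t ↦ r_N(t)²` is integrable on
`(0,∞)` for every `N` and `N · ∫₀^∞ r_N(t)² dt → 0`. Proof (the `r²` half of
`twoHorizons_meanChannels`): with `θ = (α+2)/(2α) ∈ (0,1)`, split `(0,∞)` at the causal window
`N^θ`; inside, `lightConeH_of_nonneg` gives `r_N² ≤ ε_N` with `N·ε_N·N^θ = N^{1+θ}ε_N → 0`;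
beyond, `r_N² ≤ T·S_N ≤ T·C·(1+t)^{-α}` has tail `≤ T·C·(N^θ)^{1-α}/(α-1)` and
`N·(N^θ)^{1-α} = N^{-(α-2)(α+1)/(2α)} → 0`. [folklore] -/
theorem twoHorizonsAt_pairCorr_channel {ω₂ lam β γ T : ℝ} (hω : 0 < ω₂) (hl : 0 ≤ lam)
    (hβ : 0 ≤ β) (hγ : 0 ≤ γ) (hT : 0 < T)
    (henv : ∃ C α : ℝ, 2 < α ∧ ∀ (N : ℕ) (t : ℝ), 0 ≤ t → fnorm ω₂ lam β γ T N t ≤ C * (1 + t) ^ (-α)) :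
    (∀ N : ℕ, IntegrableOn (fun t => (pairCorr ω₂ lam β γ T N t) ^ 2) (Ioi (0 : ℝ))) ∧
    Tendsto (fun N : ℕ => (N : ℝ) * ∫ t in Ioi (0 : ℝ), (pairCorr ω₂ lam β γ T N t) ^ 2) atTop (𝓝 0) := by
  obtain ⟨C, α, hα, hS⟩ := henv
  obtain ⟨hmeas, hr2, -⟩ := forecastLossH_commonPastBound_of_nonneg hω hl hβ hγ hT
  -- the window exponent θ ∈ (0,1)
  set θ : ℝ := (α + 2) / (2 * α) with hθdef
  have hα0 : 0 < α := by linarith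
  have hθ0 : 0 < θ := by rw [hθdef]; positivity
  have hθ1 : θ < 1 := by
    rw [hθdef, div_lt_one (by positivity)]; linarith
  have he2 : 1 + θ * (1 - α) = -((α - 2) * (α + 1)) / (2 * α) := by rw [hθdef]; field_simp; ring
  have he2neg : 1 + θ * (1 - α) < 0 := by
    rw [he2]
    exact div_neg_of_neg_of_pos (neg_neg_of_pos (mul_pos (by linarith) (by linarith))) (by positivity)
  obtain ⟨ε, hε, hwin⟩ := lightConeH_of_nonneg ω₂ lam β γ hω hl hβ hγ T hT θ hθ0 hθ1
  -- abbreviations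
  set S : ℕ → ℝ → ℝ := fun N t => fnorm ω₂ lam β γ T N t with hSdef
  set P : ℕ → ℝ → ℝ := fun N t => commonPast ω₂ lam β γ T N t with hPdef
  set r : ℕ → ℝ → ℝ := fun N t => pairCorr ω₂ lam β γ T N t with hrdef
  have hS0 : ∀ N t, 0 ≤ S N t := fun N t => fnorm_nonneg ω₂ lam β γ T N t
  -- C ≥ 0 (from `0 ≤ S_N(0) ≤ C`)
  have hC0 : 0 ≤ C := by
    have h := hS 0 0 le_rfl
    simp only [add_zero, Real.one_rpow, mul_one] at h
    exact (hS0 0 0).trans h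
  -- the majorant G₂ = T·C·(1+t)^{-α}
  have hrbd : ∀ (N : ℕ) (t : ℝ), 0 ≤ t → (r N t) ^ 2 ≤ T * C * (1 + t) ^ (-α) := by
    intro N t ht
    calc (r N t) ^ 2 ≤ T * S N t := hr2 N t
      _ ≤ T * (C * (1 + t) ^ (-α)) := by gcongr; exact hS N t ht
      _ = T * C * (1 + t) ^ (-α) := by ring
  set G₂ : ℝ → ℝ := fun t => T * C * (1 + t) ^ (-α) with hG₂def
  have hG₂int : IntegrableOn G₂ (Ioi (0 : ℝ)) :=
    (twoHorizons_integrableOn_one_add_rpow_neg (by linarith : (1:ℝ) < α)).const_mul _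
  -- the coherent integrand g = r²
  set g : ℕ → ℝ → ℝ := fun N t => (r N t) ^ 2 with hgdef
  have hgmeas : ∀ N, Measurable (g N) := fun N => (hmeas N).2.pow_const 2
  have hgbd : ∀ (N : ℕ) (t : ℝ), 0 ≤ t → |g N t| ≤ G₂ t := by
    intro N t ht
    simp only [hgdef, abs_of_nonneg (sq_nonneg (r N t))]
    exact hrbd N t ht
  -- fixed-N integrability by domination
  have hgint : ∀ N, IntegrableOn (g N) (Ioi (0 : ℝ)) := by
    intro N
    refine Integrable.mono' hG₂int (hgmeas N).aestronglyMeasurable ?_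
    refine (ae_restrict_iff' measurableSet_Ioi).2 (ae_of_all _ fun t (ht : 0 < t) => ?_)
    rw [Real.norm_eq_abs]
    exact hgbd N t ht.le
  -- the causal window a_N = N^θ
  set a : ℕ → ℝ := fun N => (N : ℝ) ^ θ with hadef
  have ha0 : ∀ N, 0 ≤ a N := fun N => Real.rpow_nonneg (Nat.cast_nonneg N) θ
  have hapos : ∀ N : ℕ, 1 ≤ N → 0 < a N := fun N hN =>
    Real.rpow_pos_of_pos (by exact_mod_cast Nat.lt_of_lt_of_le Nat.zero_lt_one hN) θ
  -- tail of the majorant beyond x > 0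
  have htailG₂ : ∀ {x : ℝ}, 0 < x → IntegrableOn G₂ (Ioi x) ∧
      ∫ t in Ioi x, G₂ t ≤ T * C * (x ^ (1 - α) / (α - 1)) := by
    intro x hx
    refine ⟨hG₂int.mono_set (Ioi_subset_Ioi hx.le), ?_⟩
    simp only [hG₂def]
    rw [integral_const_mul]
    exact mul_le_mul_of_nonneg_left (twoHorizons_setIntegral_Ioi_one_add_rpow_le (by linarith) hx) (by positivity)
  -- exponent bookkeeping: N · (N^θ)^(1-s) = N^(1 + θ(1-s))
  have hpow : ∀ (N : ℕ), 1 ≤ N → ∀ s : ℝ, (N : ℝ) * (a N) ^ (1 - s) = (N : ℝ) ^ (1 + θ * (1 - s)) := by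
    intro N hN s
    have hNpos : (0 : ℝ) < N := by exact_mod_cast Nat.lt_of_lt_of_le Nat.zero_lt_one hN
    simp only [hadef]
    rw [← Real.rpow_mul hNpos.le, Real.rpow_add hNpos, Real.rpow_one]
  -- the tail sequence
  set b₂ : ℕ → ℝ := fun N => T * C / (α - 1) * (N : ℝ) ^ (1 + θ * (1 - α)) with hb₂def
  have hb₂lim : Tendsto b₂ atTop (𝓝 0) := by
    have := (twoHorizons_tendsto_natCast_rpow_of_neg he2neg).const_mul (T * C / (α - 1))
    simpa [hb₂def] using this
  -- tail estimate for N ≥ 1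
  have htailg : ∀ᶠ N : ℕ in atTop, (N : ℝ) * ∫ t in Ioi (a N), |g N t| ≤ b₂ N := by
    filter_upwards [eventually_ge_atTop 1] with N hN
    have hx := hapos N hN
    obtain ⟨hG₂x, hG₂le⟩ := htailG₂ hx
    have hle : ∫ t in Ioi (a N), |g N t| ≤ ∫ t in Ioi (a N), G₂ t :=
      setIntegral_mono_on ((hgint N).mono_set (Ioi_subset_Ioi (ha0 N))).abs hG₂x measurableSet_Ioi
        (fun t ht => hgbd N t ((ha0 N).trans (le_of_lt ht)))
    have hN0 : (0 : ℝ) ≤ N := Nat.cast_nonneg N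
    calc (N : ℝ) * ∫ t in Ioi (a N), |g N t| ≤ (N : ℝ) * (T * C * ((a N) ^ (1 - α) / (α - 1))) := by
          exact mul_le_mul_of_nonneg_left (hle.trans hG₂le) hN0
      _ = T * C / (α - 1) * ((N : ℝ) * (a N) ^ (1 - α)) := by ring
      _ = b₂ N := by rw [hpow N hN α]
  -- window bound: |g| ≤ ε_N on (0, N^θ]
  have hwing : ∀ (N : ℕ) (t : ℝ), 0 < t → t ≤ a N → |g N t| ≤ ε N := by
    intro N t ht hta
    have hw := hwin N t ht.le hta
    simp only [hgdef, abs_of_nonneg (sq_nonneg (r N t))]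
    linarith [abs_nonneg (P N t)]
  -- window mass: N · (level × length) → 0
  have hNa : ∀ N : ℕ, (N : ℝ) * a N = (N : ℝ) ^ (1 + θ) := by
    intro N
    simp only [hadef]
    rw [Real.rpow_add' (Nat.cast_nonneg N) (by linarith : (1:ℝ) + θ ≠ 0), Real.rpow_one]
  have hwg : Tendsto (fun N : ℕ => (N : ℝ) * (ε N * a N)) atTop (𝓝 0) := by
    refine hε.congr (fun N => ?_)
    rw [← hNa N]; ring
  -- assemble with the abstract two-horizons lemma
  exact ⟨hgint, twoHorizons_tendsto_mul_integral_of_window_tail ha0 hgint hwing htailg hwg hb₂lim⟩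

/-! ### The registered calibration -/

/-- **The forecast-loss envelope is FALSE at the harmonic corner** (calibration of the lead's stub
`stub_forecastLoss`, line `two-horizons-forecast-loss` of crux stmt-AtomisticToContinuum-11811):
for the pinned HARMONIC chain `pinnedChain ω₂ 0 0 γ` (`ω₂, γ, T > 0`) there is NO `N`-uniform
envelope `S_N(t) ≤ C(1+t)^{-α}` with `α > 2`. Indeed such an envelope would close the coherent
channel, `N·∫₀^∞ r_N² → 0` (`twoHorizonsAt_pairCorr_channel` at `lam = β = 0`), contradicting
`HarmonicCoherentPersistence` (`harmonicCoherentPersistence_proof`: `∫₀^∞ r_N² → T² c_∞/(2γ²) > 0`,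
the Rieder–Lebowitz–Lieb ballistic conductance). [folklore] -/
theorem forecastLossEnvelope_false_harmonic : ∀ ω₂ γ : ℝ, 0 < ω₂ → 0 < γ → ∀ T : ℝ, 0 < T → ¬ (∃ C α : ℝ, 2 < α ∧ ∀ (N : ℕ) (t : ℝ), 0 ≤ t → fnorm ω₂ 0 0 γ T N t ≤ C * (1 + t) ^ (-α)) := by
  intro ω₂ γ hω hγ T hT henv
  have hlim := (twoHorizonsAt_pairCorr_channel hω le_rfl le_rfl hγ.le hT henv).2
  refine (Summit.AtomisticToContinuum.FouriersLaw.Theorems.HarmonicCoherentPersistence.harmonicCoherentPersistence_proof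
    ω₂ γ hω hγ T hT).2 ?_
  simpa only [pairCorr, fcast] using hlim

end Summit.AtomisticToContinuum.FouriersLaw.Theorems.PhononMeanFreePath

end
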